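import Summits.AtomisticToContinuum.BoseEinsteinCondensation.Theses.BECInsertionCorrector
import Literature.MathematicalPhysics.QuantumManyBody.BoseGasDirichletWall
import Literature.MathematicalPhysics.QuantumManyBody.BoseGasCatStates
import Literature.MathematicalPhysics.QuantumManyBody.BoseGasThermodynamicLimitRuelle
import Literature.Barriers.AtomisticToContinuum.KineticGapLengthScalesNarrow
import Literature.Barriers.AtomisticToContinuum.KineticGapLengthScalesThermodynamicWindow

/-!
# `BoundaryTransferWeak` (stmt-AtomisticToContinuum-0827): no ex-falso exit on either side

Negative knowledge for the per-potential boundary-condition transfer crux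
`BoundaryTransferWeak := ∀ v, IsRepulsiveFiniteRange v → A(v) → B(v)` (route file
`Theses/BECInsertionCorrector.lean`; `A(v)` = torus ground-state BEC at small densities, `B(v)` =
`∃ ρ₀ > 0, ∀ ρ ∈ (0,ρ₀), HasGroundStateBEC v ρ`), filed by its crux disprover (`--supports`; nothing
here asserts a Theses statement positively):

* (Logic, recorded in the crux work file `Cruxes/BoundaryTransferWeak/Disproof.lean`: the summit
  conjunct implies the crux, so ANY refutation of the crux refutes `BoseEinsteinCondensation`.)
* PERIODIC SIDE. `criterion_le_inv_of_top`, `criterion_nonpos_of_top`: if `E₀^per(N, L) = ⊤`, no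
  criterion "`δ`-near-minimiser ⇒ `n₀ ≥ cN`" with `c > 0` can hold, for ANY `v : ℝ → ℝ≥0∞` and any
  slack (the Galilei-boost chain `energyWindow_fraction_le_of_state` needs no finite energy when
  the window is everything); hence `torusBEC_eventually_lt_top`: the HYPOTHESIS of the crux
  self-certifies finite torus energies eventually — it is never vacuously true (over-packed hard
  cores, `v ≡ ⊤`, divergent lattice sums all make `A(v)` FALSE, so the crux holds there ex falso
  and no junk potential refutes it).
* DIRICHLET SIDE. `condensateNumber_le_of_top`, `condensateNumber_eq_zero_of_top` (`E₀^D = ⊤`,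
  `N ≥ 2` ⇒ `condensateNumber = 0`, by the fragmented cat states of `BoseGasCatStates`),
  `hasGroundStateBEC_eventually_lt_top`; `dirichlet_eventually_lt_top` — for an ADMISSIBLE `v`,
  below `1/(2(1+R)³)` the box energies are finite eventually (Ruelle finiteness of the tree).
* `not_boundaryTransferWeak_iff_honest` — HONEST NEGATION NORMAL FORM: a counterexample is an
  admissible `v` with torus BEC whose dilute DIRICHLET gas has finite energy (both b.c.) and NO
  ground-state BEC at densities accumulating at `0` — the negation of LSSY's conjecture for that
  `v`. This is why the crux resists disproof.

All `[folklore]`; theorems only.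
-/

noncomputable section

namespace Summit.AtomisticToContinuum.BoseEinsteinCondensation.Theorems.BoundaryTransferWeak.Negative

open Literature.MathematicalPhysics.QuantumManyBody.BoseGas
open Literature.Barriers.AtomisticToContinuum.BoseGas
open _root_.MeasureTheory _root_.Filter _root_.Topology
open scoped ENNReal NNReal

open Summit.AtomisticToContinuum.BoseEinsteinCondensation.Theses.BECInsertionCorrector
  (BoundaryTransferWeak)

variable {v : ℝ → ℝ≥0∞} {ρ c : ℝ} {N : ℕ} {L : ℝ}

/-! ## Periodic side: the hypothesis self-certifies finite torus energies -/

/-- **Non-vacuity**: for `L > 0` the constant state `(L^{-3/2})^N` is an admissible periodic trial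
state (every `N`). [folklore] -/
theorem nonempty_periodicTrialState (N : ℕ) (hL : 0 < L) : Nonempty (PeriodicTrialState N L) := by
  have hL3 : 0 < L ^ 3 := by positivity
  have hc : ((‖(((Real.sqrt (L ^ 3))⁻¹ ^ N : ℝ) : ℂ)‖₊ : ℝ≥0∞) ^ 2) =
      ENNReal.ofReal (((L ^ 3)⁻¹) ^ N) := by
    rw [← ENNReal.coe_pow, ENNReal.ofReal, ENNReal.coe_inj]
    ext
    rw [NNReal.coe_pow, coe_nnnorm, Complex.norm_real, Real.norm_of_nonneg (by positivity),
      ← pow_mul, mul_comm, pow_mul, inv_pow, Real.sq_sqrt hL3.le,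
      Real.coe_toNNReal _ (by positivity)]
  exact ⟨{ ψ := fun _ => (((Real.sqrt (L ^ 3))⁻¹ ^ N : ℝ) : ℂ)
           contDiff := contDiff_const
           periodic := fun _ _ _ => rfl
           symm := fun _ _ => rfl
           norm_eq := by
             rw [setLIntegral_const, volume_cellN, hc, ← ENNReal.ofReal_pow hL.le,
               ← ENNReal.ofReal_pow (by positivity), ← ENNReal.ofReal_mul (by positivity),
               ← mul_pow, inv_mul_cancel₀ hL3.ne', one_pow, ENNReal.ofReal_one] }⟩

/-- **If `E₀^per(N, L) = ⊤`, every criterion "near-minimiser ⇒ `n₀ ≥ cN`" has `c ≤ 1/(M+1)` for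
every `M`** (any slack `δ`, any `v : ℝ → ℝ≥0∞`): the window is everything, so the `M + 1` Galilei
boosts of the constant state are all "near-minimisers" and share the condensate. [folklore] -/
theorem criterion_le_inv_of_top (hL : 0 < L) (hN : 0 < N)
    (htop : periodicGroundStateEnergy v N L = ⊤) (M : ℕ) {δ : ℝ≥0∞} {c : ℝ}
    (hcrit : ∀ Ψ : PeriodicTrialState N L,
      periodicEnergy v Ψ ≤ periodicGroundStateEnergy v N L + δ →
        ENNReal.ofReal (c * N) ≤ condensateOccupation N L Ψ.ψ) :
    c ≤ 1 / (M + 1) := by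
  obtain ⟨Φ⟩ := nonempty_periodicTrialState N hL
  refine energyWindow_fraction_le_of_state hL v hN M Φ ?_ hcrit
  rw [htop, top_add]
  exact le_top

/-- **… hence `c ≤ 0`**: with `E₀^per = ⊤` no positive condensate fraction is certified by ANY
near-minimiser criterion. [folklore] -/
theorem criterion_nonpos_of_top (hL : 0 < L) (hN : 0 < N)
    (htop : periodicGroundStateEnergy v N L = ⊤) {δ : ℝ≥0∞} {c : ℝ}
    (hcrit : ∀ Ψ : PeriodicTrialState N L,
      periodicEnergy v Ψ ≤ periodicGroundStateEnergy v N L + δ →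
        ENNReal.ofReal (c * N) ≤ condensateOccupation N L Ψ.ψ) :
    c ≤ 0 := by
  by_contra hc
  push Not at hc
  obtain ⟨M, hM⟩ := exists_nat_gt (1 / c)
  have hle := criterion_le_inv_of_top hL hN htop M hcrit
  rw [div_lt_iff₀ hc] at hM
  rw [le_div_iff₀ (by positivity)] at hle
  nlinarith

/-- **Torus BEC with `c > 0` self-certifies finite torus energies**, eventually in `N`, for ANY
potential `v : ℝ → ℝ≥0∞` (the inner body of the crux's hypothesis at one density). [folklore] -/
theorem torusBEC_eventually_lt_top (hρ : 0 < ρ) (hc : 0 < c)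
    (h : ∀ᶠ N : ℕ in atTop, ∃ δ : ℝ≥0∞, 0 < δ ∧
      ∀ Ψ : PeriodicTrialState N (sideLength ρ N),
        periodicEnergy v Ψ ≤ periodicGroundStateEnergy v N (sideLength ρ N) + δ →
          ENNReal.ofReal (c * N) ≤ condensateOccupation N (sideLength ρ N) Ψ.ψ) :
    ∀ᶠ N : ℕ in atTop, periodicGroundStateEnergy v N (sideLength ρ N) < ⊤ := by
  filter_upwards [h, eventually_gt_atTop 0] with N ⟨δ, _, hcrit⟩ hN
  rw [lt_top_iff_ne_top]
  intro htop
  exact (not_le.2 hc) (criterion_nonpos_of_top (sideLength_pos_of_pos hρ hN) hN htop hcrit)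

/-- **The hypothesis `A(v)` of the crux is never vacuous**: it forces finite torus energies
eventually at every density below its own `ρ₀` — for every `v : ℝ → ℝ≥0∞`, admissible or not.
[folklore] -/
theorem antecedent_eventually_lt_top
    (h : ∃ ρ₀ : ℝ, 0 < ρ₀ ∧ ∀ ρ : ℝ, 0 < ρ → ρ < ρ₀ → ∃ c : ℝ, 0 < c ∧
      ∀ᶠ N : ℕ in atTop, ∃ δ : ℝ≥0∞, 0 < δ ∧
        ∀ Ψ : PeriodicTrialState N (sideLength ρ N),
          periodicEnergy v Ψ ≤ periodicGroundStateEnergy v N (sideLength ρ N) + δ →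
            ENNReal.ofReal (c * N) ≤ condensateOccupation N (sideLength ρ N) Ψ.ψ) :
    ∃ ρ₀ : ℝ, 0 < ρ₀ ∧ ∀ ρ : ℝ, 0 < ρ → ρ < ρ₀ →
      ∀ᶠ N : ℕ in atTop, periodicGroundStateEnergy v N (sideLength ρ N) < ⊤ := by
  obtain ⟨ρ₀, hρ₀, hA⟩ := h
  refine ⟨ρ₀, hρ₀, fun ρ hρ hρρ₀ => ?_⟩
  obtain ⟨c, hc, hT⟩ := hA ρ hρ hρρ₀
  exact torusBEC_eventually_lt_top hρ hc hT

/-! ## Dirichlet side: `E₀^D = ⊤` kills `condensateNumber` -/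

/-- **If `E₀^D(N, L) = ⊤` then `condensateNumber ≤ N/m³` for every `m ≥ 1`** (`N ≥ 2`, `L > 0`):
every Dirichlet state is a "near-minimiser", in particular the fragmented cat state of
`BoseGasCatStates` with `λ_max ≤ N/m³`. [folklore] -/
theorem condensateNumber_le_of_top (hL : 0 < L) (hN : 2 ≤ N)
    (htop : groundStateEnergy v N L = ⊤) {m : ℕ} (hm : 0 < m) :
    condensateNumber v N L ≤ ENNReal.ofReal (N / m ^ 3) := by
  obtain ⟨Ψ, _, hocc⟩ := exists_fragmented_trialState hm hN hL
  refine iSup₂_le fun δ _ => ?_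
  refine (iInf₂_le Ψ ?_).trans hocc
  rw [htop, top_add]
  exact le_top

/-- **… hence `condensateNumber = 0`.** [folklore] -/
theorem condensateNumber_eq_zero_of_top (hL : 0 < L) (hN : 2 ≤ N)
    (htop : groundStateEnergy v N L = ⊤) : condensateNumber v N L = 0 := by
  refine le_antisymm ?_ bot_le
  refine ENNReal.le_of_forall_pos_le_add fun ε hε _ => ?_
  rw [zero_add]
  obtain ⟨m, hm⟩ := exists_nat_gt ((N : ℝ) / ε)
  have hm0 : 0 < m := by
    have : (0 : ℝ) < m := lt_of_le_of_lt (by positivity) hm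
    exact_mod_cast this
  refine (condensateNumber_le_of_top hL hN htop hm0).trans ?_
  rw [← ENNReal.ofReal_coe_nnreal]
  refine ENNReal.ofReal_le_ofReal ?_
  have hε' : (0 : ℝ) < ε := hε
  have hm1 : (1 : ℝ) ≤ m := by exact_mod_cast hm0
  have hm3 : (m : ℝ) ≤ (m : ℝ) ^ 3 := le_self_pow₀ hm1 three_ne_zero
  rw [div_lt_iff₀ hε'] at hm
  rw [div_le_iff₀ (by positivity)]
  nlinarith [hm3, hε'.le]

/-- **Dirichlet BEC self-certifies finite box energies** eventually (any `v`, `ρ > 0`).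
[folklore] -/
theorem hasGroundStateBEC_eventually_lt_top (hρ : 0 < ρ) (h : HasGroundStateBEC v ρ) :
    ∀ᶠ N : ℕ in atTop, groundStateEnergy v N (sideLength ρ N) < ⊤ := by
  obtain ⟨c, hc, hev⟩ := h
  filter_upwards [hev, eventually_ge_atTop 2] with N hN h2
  rw [lt_top_iff_ne_top]
  intro htop
  have hL : 0 < sideLength ρ N := sideLength_pos_of_pos hρ (by omega)
  rw [condensateNumber_eq_zero_of_top hL h2 htop, nonpos_iff_eq_zero, ENNReal.ofReal_eq_zero] at hN
  have : (0 : ℝ) < c * N := by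
    have : (0 : ℝ) < N := by exact_mod_cast (show 0 < N by omega)
    positivity
  linarith

/-- **For an ADMISSIBLE `v` the box energies are finite eventually at small density** (Ruelle
finiteness, in the tree): below `ρ₁ = 1/(2(1+R)³)`. [folklore] -/
theorem dirichlet_eventually_lt_top (hv : IsRepulsiveFiniteRange v) :
    ∃ ρ₁ : ℝ, 0 < ρ₁ ∧ ∀ ρ : ℝ, 0 < ρ → ρ < ρ₁ →
      ∀ᶠ N : ℕ in atTop, groundStateEnergy v N (sideLength ρ N) < ⊤ := by
  obtain ⟨R, hR, hv0⟩ := hv.exists_pos_range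
  refine ⟨1 / (2 * (1 + R) ^ 3), by positivity, fun ρ hρ hρ₁ => ?_⟩
  have hsmall : ρ * (1 + R) ^ 3 < 1 := by
    rw [lt_div_iff₀ (by positivity)] at hρ₁
    nlinarith [pow_pos (show (0:ℝ) < 1 + R by linarith) 3]
  have hfin := limsup_lt_top_of_small hv.1 hv0 hR hρ hsmall
  have hev : ∀ᶠ N : ℕ in atTop, energyPerParticleDirichlet v ρ N < ⊤ :=
    eventually_lt_of_limsup_lt hfin
  filter_upwards [hev, eventually_gt_atTop 0] with N hD hN
  unfold energyPerParticleDirichlet at hD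
  by_contra htop
  rw [not_lt, top_le_iff] at htop
  rw [htop, ENNReal.top_div_of_ne_top (ENNReal.natCast_ne_top N)] at hD
  exact lt_irrefl _ hD

/-! ## The honest negation normal form -/

/-- **HONEST NEGATION NORMAL FORM of the crux.** `¬BoundaryTransferWeak` holds iff some
admissible `v` has torus BEC at small densities (the crux's hypothesis, verbatim) while at
densities accumulating at `0` its Dirichlet AND periodic box energies are finite eventually and
yet `HasGroundStateBEC v ρ` fails — an honest counterexample to the dilute BEC conjecture for that
`v`; no degenerate reading of either side is available. [folklore] -/
theorem not_boundaryTransferWeak_iff_honest :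
    ¬ BoundaryTransferWeak ↔
      ∃ v : ℝ → ℝ≥0∞, IsRepulsiveFiniteRange v ∧
        (∃ ρ₀ : ℝ, 0 < ρ₀ ∧ ∀ ρ : ℝ, 0 < ρ → ρ < ρ₀ → ∃ c : ℝ, 0 < c ∧
          ∀ᶠ N : ℕ in atTop, ∃ δ : ℝ≥0∞, 0 < δ ∧
            ∀ Ψ : PeriodicTrialState N (sideLength ρ N),
              periodicEnergy v Ψ ≤ periodicGroundStateEnergy v N (sideLength ρ N) + δ →
                ENNReal.ofReal (c * N) ≤ condensateOccupation N (sideLength ρ N) Ψ.ψ) ∧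
        ∀ ρ₀ : ℝ, 0 < ρ₀ → ∃ ρ : ℝ, 0 < ρ ∧ ρ < ρ₀ ∧
          (∀ᶠ N : ℕ in atTop, groundStateEnergy v N (sideLength ρ N) < ⊤) ∧
          (∀ᶠ N : ℕ in atTop, periodicGroundStateEnergy v N (sideLength ρ N) < ⊤) ∧
            ¬ HasGroundStateBEC v ρ := by
  constructor
  · intro h
    unfold BoundaryTransferWeak at h
    push Not at h
    obtain ⟨v, hv, hA, hB⟩ := h
    obtain ⟨ρ₁, hρ₁, hD⟩ := dirichlet_eventually_lt_top hv
    obtain ⟨ρ₂, hρ₂, hP⟩ := exists_eventually_periodicGroundStateEnergy_lt_top hv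
    refine ⟨v, hv, hA, fun ρ₀ hρ₀ => ?_⟩
    obtain ⟨ρ, hρ, hlt, hB'⟩ := hB (min ρ₀ (min ρ₁ ρ₂)) (lt_min hρ₀ (lt_min hρ₁ hρ₂))
    have h0 : ρ < ρ₀ := hlt.trans_le (min_le_left _ _)
    have h1 : ρ < ρ₁ := hlt.trans_le ((min_le_right _ _).trans (min_le_left _ _))
    have h2 : ρ < ρ₂ := hlt.trans_le ((min_le_right _ _).trans (min_le_right _ _))
    exact ⟨ρ, hρ, h0, hD ρ hρ h1, hP ρ hρ h2, hB'⟩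
  · rintro ⟨v, hv, hA, hB⟩ h
    obtain ⟨ρ₀, hρ₀, hBEC⟩ := h v hv hA
    obtain ⟨ρ, hρ, h0, _, _, hno⟩ := hB ρ₀ hρ₀
    exact hno (hBEC ρ hρ h0)

end Summit.AtomisticToContinuum.BoseEinsteinCondensation.Theorems.BoundaryTransferWeak.Negative

end
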